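import Summits.ValiantsHypothesis.ValiantsHypothesis.Theorems.LacunarySymmetroidMatrixDescartesDoorA26WallBubblingOnePairWallChain
import Summits.ValiantsHypothesis.ValiantsHypothesis.Theorems.LacunarySymmetroidMatrixDescartesDoorA26WallBubblingOnePairWallRelations
import Summits.ValiantsHypothesis.ValiantsHypothesis.Theorems.LacunarySymmetroidMatrixDescartesDoorA26WallBubblingWeylGenericReduction

/-!
# Wall bubbling for `DoorA26` — ONE WEYL PAIR ON A WALL: NOT A LIMIT OF TWENTIES (the line's closure currency; door-free, unconditional)

HONEST FRAMING.  Obligation (W) `stub_weylFaces` of `Cruxes/DoorA26/Lines/wall_bubbling.lean` (crux `DoorA26`, stmt-ValiantsHypothesis-19979;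
OPEN, typed, never asserted); statement file `Cruxes/DoorA26/Lines/wall_bubbling_ConfluentDoor.lean` rev 5d, stratum
`Stmt.weylFaces_wall := ∀ δ ∈ SortedSimplex, HasWeylCoincidence δ → ¬ HasMixedCoincidence δ → ¬ IsValueGeneric δ → δ ∉ closure TwentyLocus`.
W1 seat val-sym-door-p2 g13 (#42).  THIS FILE settles the ONE-PAIR PART of that stratum — the points whose only coincidence of letters is ONE pair
(`honePair`; a triple is a mixed coincidence, two pairs are the (c1)/(c2)/(c3) strata whose multi-cluster branch needs two-dslope rungs, OPEN) —
in the line's own currency, with the line's predicates INLINED VERBATIM (`Cruxes/` is not importable; `SortedSimplex`, `TwentyLocus` are the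
Theorems-side verbatim copies of `…BubblingDefs`, p618256, exactly as in W2 #27 `…WeylGenericReduction`):

* **`not_mem_closure_twentyLocus_onePairWall`** : `∀ δ ∈ SortedSimplex, (∃ i j, i ≠ j ∧ δ i = δ j) → ¬ (∃ i k l, i ≠ k ∧ i ≠ l ∧ k ≠ l ∧ 2 * δ i = δ k + δ l)
  → ¬ (∀ a b c d, δ a + δ b = δ c + δ d → (δ a = δ c ∧ δ b = δ d) ∨ (δ a = δ d ∧ δ b = δ c)) → honePair → δ ∉ closure TwentyLocus`.

PROOF = bookkeeping over the tree: entrance `mem_closure_iff_seq_limit` + W2's `twenty_log_zeros_of_mem_twentyLocus` (a sequence of genuine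
pencils with twenty log-zeros and exponents `→ δ`); the non-generic relation has four distinct values (no mixed relation), is moved off the letter `j`,
and is UNIQUE (W1 #42a `relClass_onePairWallA/B`: five distinct values, no three-term relation); a relabelling `g` of the six positions (pair at `0, 5`,
relation in normal position (a) `1+2 = 3+4` or (b) `0+1 = 2+3`; sums reindexed by `Fintype.sum_bijective`) feeds W1 #41
`onePairWallA_noTwenties` / `onePairWallB_noTwenties` (no accumulation of twenties at all at such a point; door-free; non-degeneracy W1 #35, clusters
W1 #40 over W2's part A, rungs and count W2's parts B1/B2, ceiling W2 #17 with `|V| ≤ 14`).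

So the one-pair part of `Stmt.weylFaces_wall` is PROVED outright (no door, no NoTightChain26).  What remains of `Stmt.weylFaces_wall`: the two-pair wall
strata (c1)/(c2)/(c3), multi-cluster branch (single-cluster branch: W1 #28).  Registers unchanged; (W), `ConfluentDoor26`, `NoTightChain26(NC)`,
`DoorA26` 19979, `MatrixDescartes` 18050 OPEN, typed never asserted; nothing on VP ≠ VNP.  Def-free.  `--supports stmt-ValiantsHypothesis-19979 --as helper`.

[folklore] metric closure, relabelling.  [this work] the assembly.
-/

-- `Summit.ValiantsHypothesis.ValiantsHypothesis.…` repeats a component by the D-0017 layout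
-- (single-conjunct summit), which the `dupNamespace` linter flags; the name is mandated.
set_option linter.dupNamespace false

namespace Summit.ValiantsHypothesis.ValiantsHypothesis.Theorems.LacunarySymmetroidMatrixDescartes.WallBubbling

open Finset Filter Topology
open Bubbling (polar TwentyLocus SortedSimplex)
open scoped BigOperators

/-- **Relabelled chain run.**  Exponents `δseq ν → δ`, genuine symmetric pencils with twenty strictly increasing log-zeros at every stage, and an
INJECTIVE relabelling `g` of the six positions with `δ (g 5) = δ (g 0)`, the five values `δ (g 0), …, δ (g 4)` pairwise distinct without three-term
relation, and the wall relation in normal position (a) `δ(g 1) + δ(g 2) = δ(g 3) + δ(g 4)` or (b) `δ(g 0) + δ(g 1) = δ(g 2) + δ(g 3)`: impossible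
(W1 #41 after reindexing the sums). [this work] -/
theorem onePairWall_noTwenties_relabelled (δseq : ℕ → Fin 6 → ℝ) (δ : Fin 6 → ℝ)
    (hδ : ∀ l, Tendsto (fun ν => δseq ν l) atTop (𝓝 (δ l)))
    (S : ℕ → Fin 6 → Matrix (Fin 2) (Fin 2) ℝ) (hS : ∀ ν l, (S ν l).IsSymm)
    (hneS : ∀ ν, ∃ t, (∑ l, Real.exp (δseq ν l * t) • S ν l).det ≠ 0)
    (z : ℕ → Fin 20 → ℝ) (hz : ∀ ν, StrictMono (z ν)) (hroot : ∀ ν i, (∑ l, Real.exp (δseq ν l * z ν i) • S ν l).det = 0)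
    (g : Fin 6 → Fin 6) (hg : Function.Injective g) (h05 : δ (g 5) = δ (g 0))
    (hinj : ∀ a b : Fin 5, δ (g a.castSucc) = δ (g b.castSucc) → a = b)
    (hnoAP : ∀ x y w : Fin 5, x ≠ y → x ≠ w → y ≠ w → 2 * δ (g x.castSucc) ≠ δ (g y.castSucc) + δ (g w.castSucc))
    (hrel : δ (g 1) + δ (g 2) = δ (g 3) + δ (g 4) ∨ δ (g 0) + δ (g 1) = δ (g 2) + δ (g 3)) : False := by
  classical
  have hbij : Function.Bijective g := Finite.injective_iff_bijective.mp hg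
  have hsumg : ∀ F : Fin 6 → Matrix (Fin 2) (Fin 2) ℝ, ∑ k, F (g k) = ∑ l, F l :=
    fun F => Fintype.sum_bijective g hbij (fun k => F (g k)) F (fun _ => rfl)
  have hne' : ∀ ν, ∃ t, (∑ k, Real.exp (δseq ν (g k) * t) • S ν (g k)).det ≠ 0 := by
    intro ν
    obtain ⟨t, ht⟩ := hneS ν
    exact ⟨t, by rw [hsumg (fun l => Real.exp (δseq ν l * t) • S ν l)]; exact ht⟩
  have hroot' : ∀ ν i, (∑ k, Real.exp (δseq ν (g k) * z ν i) • S ν (g k)).det = 0 := by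
    intro ν i
    rw [hsumg (fun l => Real.exp (δseq ν l * z ν i) • S ν l)]
    exact hroot ν i
  rcases hrel with hA | hB
  · exact onePairWallA_noTwenties (fun ν k => δseq ν (g k)) (fun k => δ (g k)) (fun k => hδ (g k)) h05 hA
      (relClass_onePairWallA (fun m => δ (g m.castSucc)) hinj hnoAP hA)
      (fun ν k => S ν (g k)) (fun ν k => hS ν (g k)) hne' z hz hroot'
  · exact onePairWallB_noTwenties (fun ν k => δseq ν (g k)) (fun k => δ (g k)) (fun k => hδ (g k)) h05 hB
      (relClass_onePairWallB (fun m => δ (g m.castSucc)) hinj hnoAP hB)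
      (fun ν k => S ν (g k)) (fun ν k => hS ν (g k)) hne' z hz hroot'

/-- Injectivity of a six-vector from the fifteen pairwise disequalities. [folklore] -/
theorem injective_vec6 (x0 x1 x2 x3 x4 x5 : Fin 6) (h01 : x0 ≠ x1) (h02 : x0 ≠ x2) (h03 : x0 ≠ x3) (h04 : x0 ≠ x4) (h05 : x0 ≠ x5)
    (h12 : x1 ≠ x2) (h13 : x1 ≠ x3) (h14 : x1 ≠ x4) (h15 : x1 ≠ x5) (h23 : x2 ≠ x3) (h24 : x2 ≠ x4) (h25 : x2 ≠ x5)
    (h34 : x3 ≠ x4) (h35 : x3 ≠ x5) (h45 : x4 ≠ x5) : Function.Injective ![x0, x1, x2, x3, x4, x5] := by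
  have h6 : ∀ x : Fin 6, x = 0 ∨ x = 1 ∨ x = 2 ∨ x = 3 ∨ x = 4 ∨ x = 5 := by decide
  intro p q hpq
  rcases h6 p with rfl | rfl | rfl | rfl | rfl | rfl <;> rcases h6 q with rfl | rfl | rfl | rfl | rfl | rfl
  all_goals first
    | rfl
    | (simp only [Matrix.cons_val_zero, Matrix.cons_val_one, Matrix.cons_val] at hpq
       first
        | exact absurd hpq h01 | exact absurd hpq.symm h01 | exact absurd hpq h02 | exact absurd hpq.symm h02
        | exact absurd hpq h03 | exact absurd hpq.symm h03 | exact absurd hpq h04 | exact absurd hpq.symm h04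
        | exact absurd hpq h05 | exact absurd hpq.symm h05 | exact absurd hpq h12 | exact absurd hpq.symm h12
        | exact absurd hpq h13 | exact absurd hpq.symm h13 | exact absurd hpq h14 | exact absurd hpq.symm h14
        | exact absurd hpq h15 | exact absurd hpq.symm h15 | exact absurd hpq h23 | exact absurd hpq.symm h23
        | exact absurd hpq h24 | exact absurd hpq.symm h24 | exact absurd hpq h25 | exact absurd hpq.symm h25
        | exact absurd hpq h34 | exact absurd hpq.symm h34 | exact absurd hpq h35 | exact absurd hpq.symm h35
        | exact absurd hpq h45 | exact absurd hpq.symm h45)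

/-- **A ONE-WEYL-PAIR POINT OF THE WALL STRATUM IS NOT A LIMIT OF TWENTIES** — the one-pair part of `Stmt.weylFaces_wall`, in the line's currency
(`SortedSimplex`, `TwentyLocus` the Theorems-side verbatim copies; `HasWeylCoincidence`, `HasMixedCoincidence`, `IsValueGeneric` inlined verbatim),
plus `honePair`: every coincidence of two letters is the pair `{i, j}`.  UNCONDITIONAL: no door, no tight-chain residual. [this work] -/
theorem not_mem_closure_twentyLocus_onePairWall :
    ∀ δ ∈ SortedSimplex, (∃ i j : Fin 6, i ≠ j ∧ δ i = δ j) →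
      ¬ (∃ i k l : Fin 6, i ≠ k ∧ i ≠ l ∧ k ≠ l ∧ 2 * δ i = δ k + δ l) →
      ¬ (∀ a b c d : Fin 6, δ a + δ b = δ c + δ d → (δ a = δ c ∧ δ b = δ d) ∨ (δ a = δ d ∧ δ b = δ c)) →
      (∀ i j k l : Fin 6, i ≠ j → δ i = δ j → k ≠ l → δ k = δ l → k = i ∨ k = j) →
      δ ∉ closure TwentyLocus := by
  intro δ _ hW hM hV honePair hcl
  classical
  obtain ⟨i, j, hij, hδij⟩ := hW
  -- (0) the entrance: a sequence of genuine pencils with twenty log-zeros and exponents `→ δ`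
  obtain ⟨δseq, hmem, hlim⟩ := mem_closure_iff_seq_limit.mp hcl
  choose S hS hneS z hz hroot using fun ν => twenty_log_zeros_of_mem_twentyLocus (hmem ν)
  have hδ : ∀ l, Tendsto (fun ν => δseq ν l) atTop (𝓝 (δ l)) := fun l => (tendsto_pi_nhds.mp hlim) l
  -- (1) value bookkeeping: the only coincidence of letters is `{i, j}`; no three-term relation
  have hval : ∀ k l : Fin 6, δ k = δ l → k = l ∨ (k = i ∧ l = j) ∨ (k = j ∧ l = i) := by
    intro k l hkl
    by_cases hkl' : k = l
    · exact Or.inl hkl'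
    rcases honePair i j k l hij hδij hkl' hkl with hk | hk <;>
      rcases honePair i j l k hij hδij (Ne.symm hkl') hkl.symm with hl | hl
    · exact absurd (hk.trans hl.symm) hkl'
    · exact Or.inr (Or.inl ⟨hk, hl⟩)
    · exact Or.inr (Or.inr ⟨hk, hl⟩)
    · exact absurd (hk.trans hl.symm) hkl'
  have hM' : ∀ a k l : Fin 6, a ≠ k → a ≠ l → k ≠ l → 2 * δ a ≠ δ k + δ l :=
    fun a k l hak hal hkl h => hM ⟨a, k, l, hak, hal, hkl, h⟩
  -- (2) the non-generic relation, moved off the letter `j`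
  push Not at hV
  obtain ⟨a0, b0, c0, d0, hsum0, hn10, hn20⟩ := hV
  have hoff : ∀ x : Fin 6, ∃ x' : Fin 6, x' ≠ j ∧ δ x' = δ x :=
    fun x => if hx : x = j then ⟨i, hij, by rw [hx, hδij]⟩ else ⟨x, hx, rfl⟩
  obtain ⟨a, haj, ha⟩ := hoff a0
  obtain ⟨b, hbj, hb⟩ := hoff b0
  obtain ⟨c, hcj, hc⟩ := hoff c0
  obtain ⟨d, hdj, hd⟩ := hoff d0
  have hsum : δ a + δ b = δ c + δ d := by rw [ha, hb, hc, hd]; exact hsum0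
  have hn1 : δ a = δ c → δ b ≠ δ d := by rw [ha, hb, hc, hd]; exact hn10
  have hn2 : δ a = δ d → δ b ≠ δ c := by rw [ha, hb, hc, hd]; exact hn20
  -- four distinct values
  have hac : δ a ≠ δ c := fun h => hn1 h (by linarith)
  have had : δ a ≠ δ d := fun h => hn2 h (by linarith)
  have hbd : δ b ≠ δ d := fun h => hac (by linarith)
  have hbc : δ b ≠ δ c := fun h => had (by linarith)
  have hab : δ a ≠ δ b := by
    intro h
    have hcd : c ≠ d := fun hcd => by subst hcd; exact hac (by linarith)
    exact hM' a c d (ne_of_apply_ne δ hac) (ne_of_apply_ne δ had) hcd (by linarith)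
  have hcd : δ c ≠ δ d := by
    intro h
    exact hM' c a b (ne_of_apply_ne δ hac.symm) (ne_of_apply_ne δ hbc.symm) (ne_of_apply_ne δ hab) (by linarith)
  -- (3) the common end: an injective relabelling with the pair at `0, 5` and the relation in normal position
  have common : ∀ g : Fin 6 → Fin 6, Function.Injective g → g 0 = i → g 5 = j →
      (δ (g 1) + δ (g 2) = δ (g 3) + δ (g 4) ∨ δ (g 0) + δ (g 1) = δ (g 2) + δ (g 3)) → False := by
    intro g hg hg0 hg5 hrel
    have hgj : ∀ x : Fin 5, g x.castSucc ≠ j := by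
      intro x hx
      rw [← hg5] at hx
      exact absurd (Fin.castSucc_lt_last x) (by rw [show Fin.last 5 = (5 : Fin 6) from rfl, ← hg hx]; exact lt_irrefl _)
    have hinj : ∀ x y : Fin 5, δ (g x.castSucc) = δ (g y.castSucc) → x = y := by
      intro x y hxy
      rcases hval _ _ hxy with h | ⟨-, h⟩ | ⟨h, -⟩
      · exact Fin.castSucc_injective _ (hg h)
      · exact absurd h (hgj y)
      · exact absurd h (hgj x)
    have hnoAP : ∀ x y w : Fin 5, x ≠ y → x ≠ w → y ≠ w →
        2 * δ (g x.castSucc) ≠ δ (g y.castSucc) + δ (g w.castSucc) := by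
      intro x y w hxy hxw hyw
      refine hM' _ _ _ ?_ ?_ ?_
      · exact fun h => hxy (Fin.castSucc_injective _ (hg h))
      · exact fun h => hxw (Fin.castSucc_injective _ (hg h))
      · exact fun h => hyw (Fin.castSucc_injective _ (hg h))
    have h05 : δ (g 5) = δ (g 0) := by rw [hg5, hg0, hδij]
    exact onePairWall_noTwenties_relabelled δseq δ hδ S hS hneS z hz hroot g hg h05 hinj hnoAP hrel
  -- (4) normalise: `i ∉ {b, c, d}` (else permute the relation), then type (b) `i = a` / type (a) `i ∉ {a, b, c, d}`
  have key : ∀ a b c d : Fin 6, a ≠ j → b ≠ j → c ≠ j → d ≠ j → i ≠ b → i ≠ c → i ≠ d →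
      δ a ≠ δ b → δ a ≠ δ c → δ a ≠ δ d → δ b ≠ δ c → δ b ≠ δ d → δ c ≠ δ d →
      δ a + δ b = δ c + δ d → False := by
    intro a b c d haj hbj hcj hdj hib hic hid hab hac had hbc hbd hcd hsum
    by_cases hia : i = a
    · -- type (b): the pair's value takes part in the relation; fifth letter `m`
      subst hia
      obtain ⟨m, hm⟩ : ∃ m : Fin 6, m ∉ ({i, j, b, c, d} : Finset (Fin 6)) := by
        have hlt : ({i, j, b, c, d} : Finset (Fin 6)).card < (Finset.univ : Finset (Fin 6)).card :=
          lt_of_le_of_lt Finset.card_le_five (by rw [Finset.card_univ, Fintype.card_fin]; norm_num)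
        obtain ⟨m, -, hm⟩ := Finset.exists_mem_notMem_of_card_lt_card hlt
        exact ⟨m, hm⟩
      simp only [Finset.mem_insert, Finset.mem_singleton, not_or] at hm
      obtain ⟨hmi, hmj, hmb, hmc, hmd⟩ := hm
      refine common ![i, b, c, d, m, j]
        (injective_vec6 i b c d m j hib hic hid (Ne.symm hmi) hij (ne_of_apply_ne δ hbc) (ne_of_apply_ne δ hbd) (Ne.symm hmb) hbj
          (ne_of_apply_ne δ hcd) (Ne.symm hmc) hcj (Ne.symm hmd) hdj hmj) rfl rfl (Or.inr ?_)
      simp only [Matrix.cons_val_zero, Matrix.cons_val_one, Matrix.cons_val]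
      exact hsum
    · -- type (a): the relation is among the four singles
      refine common ![i, a, b, c, d, j]
        (injective_vec6 i a b c d j hia hib hic hid hij (ne_of_apply_ne δ hab) (ne_of_apply_ne δ hac) (ne_of_apply_ne δ had) haj
          (ne_of_apply_ne δ hbc) (ne_of_apply_ne δ hbd) hbj (ne_of_apply_ne δ hcd) hcj hdj) rfl rfl (Or.inl ?_)
      simp only [Matrix.cons_val_zero, Matrix.cons_val_one, Matrix.cons_val]
      exact hsum
  -- dispatch on where `i` sits
  by_cases hib : i = b
  · subst hib
    exact key i a c d hbj haj hcj hdj (ne_of_apply_ne δ hab.symm) (ne_of_apply_ne δ hbc) (ne_of_apply_ne δ hbd)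
      hab.symm hbc hbd hac had hcd (by linarith)
  by_cases hic : i = c
  · subst hic
    exact key i d a b hcj hdj haj hbj (ne_of_apply_ne δ hcd) (ne_of_apply_ne δ hac.symm) (ne_of_apply_ne δ hbc.symm)
      hcd hac.symm hbc.symm had.symm hbd.symm hab (by linarith)
  by_cases hid : i = d
  · subst hid
    exact key i c a b hdj hcj haj hbj (ne_of_apply_ne δ hcd.symm) (ne_of_apply_ne δ had.symm) (ne_of_apply_ne δ hbd.symm)
      hcd.symm had.symm hbd.symm hac.symm hbc.symm hab (by linarith)
  exact key a b c d haj hbj hcj hdj hib hic hid hab hac had hbc hbd hcd hsum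

end Summit.ValiantsHypothesis.ValiantsHypothesis.Theorems.LacunarySymmetroidMatrixDescartes.WallBubbling
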